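import Mathlib
import Summits.NavierStokesRegularity.NavierStokesRegularity.Theorems.LerayQuarterDissipationFiniteDissipationLiouvilleMicroscaleWindowEnvelope
import Summits.NavierStokesRegularity.NavierStokesRegularity.Theorems.LerayQuarterDissipationFiniteDissipationLiouvillePersistenceSeq
import Summits.NavierStokesRegularity.NavierStokesRegularity.Theorems.LerayQuarterDissipationRecurrentReductionDScaling
import Summits.NavierStokesRegularity.NavierStokesRegularity.Theorems.LerayQuarterDissipationFiniteDissipationLiouvilleTrapping
import HarnessLib

/-!
# Crux `FiniteDissipationLiouville` (stmt-NavierStokesRegularity-22144): THE EXTREMAL SLICE — a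
# singular member of the hull whose dimensionless enstrophy is globally MAXIMAL at `t = −1`, and at
# that slice the vorticity Taylor microscale lies EXACTLY in the window

Theorems file of route `LerayQuarterDissipation` (lead prover g18; `--supports` the crux; sequel of
`…MicroscaleWindow(Envelope)`). Navier–Stokes regularity is NOT proved by anything here; no summit is.

`…MicroscaleWindow.window_of_deriv_nonneg'` gives the window `(4D+Z)² ≤ 16C²ZD` at every instant
where the global similarity enstrophy `Z` is non-decreasing; `…exists_near_window_of_law` gives its
recurrence up to `O(1/L)`. This file realises the window EXACTLY on a canonical object:

* **`exists_extremal_slice`** — for a member `V` of the stratum (`IsTypeIAncientMild C V`, law `K`)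
  with a Type-I envelope (`HasTypeIDecay A V`), SINGULAR at the apex, there is a field `W` — a
  pointwise limit of parabolic rescalings of `V` — in the same class (Type-I constant `C`, envelope
  `A`, law `K`), SINGULAR at the apex (persistence), whose similarity enstrophy attains at `s = 0`
  (slice `t = −1`) the SUPREMUM `m` of the enstrophies of all slices of `V` and of `W`
  (compactness `…Compactness.seqLimit` along a maximising sequence of slices, continuity of the slice
  enstrophy `…CrossFlow.tendsto_integral_sq_norm_curl_neg_one`);
* **`exists_extremal_window`** — consequently `Z_W'(0) = 0` and the window holds exactly at that
  slice: `(4D + m)² ≤ 16C²·m·D`, `D = ∫‖curl curl W(−1)‖²`, `m = ∫‖curl W(−1)‖² = sup_t √(−t)∫‖curl V(t)‖²`: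
  **on the extremal slice the vorticity Taylor microscale satisfies
  `2(C − √(C²−1)) ≤ ‖curl W(−1)‖₂/‖∇curl W(−1)‖₂ ≤ 2(C + √(C²−1))` exactly**, with `C` the crux's own
  Type-I constant (necessarily `C ≥ 1` there, re-deriving threshold one's floor).

HONEST FRAMING. A compactness repackaging of the window on a HYPOTHETICAL object; `W` is not claimed
to be `V` or a rescaling of it (it lies in the closure of the scaling orbit). Nothing is removed from
the catalogued DSS wall; verdict of the line unchanged (FRONTIER). Nothing here bears on
Navier–Stokes regularity.

References: Koch–Nadirashvili–Seregin–Šverák, Acta Math. 203 (2009) §4 (compactness, persistence);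
folklore energy method.
-/

noncomputable section

set_option linter.dupNamespace false

namespace Summit.NavierStokesRegularity.NavierStokesRegularity.Theorems.FiniteDissipationLiouville.MicroscaleWindow

open MeasureTheory Set Filter Topology Metric InnerProductSpace Function Real
open scoped RealInnerProductSpace ContDiff
open Literature.Analysis Literature.Analysis.FluidPDE
open Summit.NavierStokesRegularity.NavierStokesRegularity.Theorems
open Summit.NavierStokesRegularity.NavierStokesRegularity.Theorems.GaussianGap
open Summit.NavierStokesRegularity.NavierStokesRegularity.Theorems.SimilarityEnstrophy
open Summit.NavierStokesRegularity.NavierStokesRegularity.Theorems.RecurrentReductionD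
open Summit.NavierStokesRegularity.NavierStokesRegularity.Theorems.FiniteDissipationLiouville
open Summit.NavierStokesRegularity.NavierStokesRegularity.Theorems.FiniteDissipationLiouville.CrossFlow

variable {C A K : ℝ} {V : ℝ → EuclideanSpace ℝ (Fin 3) → EuclideanSpace ℝ (Fin 3)}

/-- **THE EXTREMAL SLICE.** For a member `V` of the stratum `𝒟_{C,K}` with a Type-I envelope `A`,
singular at the apex, there is `W` in the same class (Type-I constant `C`, envelope `A`, law `K`),
singular at the apex, a pointwise limit of rescalings of `V`, whose similarity enstrophy at `s = 0`
equals the supremum `m` of the similarity enstrophies of all slices of `V`, and dominates all its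
own slices: `Z_W(s) ≤ Z_W(0) = m` and `Z_V(s) ≤ m` for every `s`.
[cite: KochNadirashviliSereginSverak2009, §4 (arXiv:0709.3599 p. 8)] -/
theorem exists_extremal_slice (hV : IsTypeIAncientMild C V) (hdec : HasTypeIDecay A V)
    (hK : ∀ s : ℝ, s < 0 → ∫⁻ x, ‖fderiv ℝ (V s) x‖ₑ ^ 2 ≤ ENNReal.ofReal (K / Real.sqrt (-s)))
    (hsing : ∀ r > 0, ∀ M : ℝ, ∃ t ∈ Ioo (-(r ^ 2)) (0 : ℝ),
      ∃ x ∈ ball (0 : EuclideanSpace ℝ (Fin 3)) r, M < ‖V t x‖) :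
    ∃ W : ℝ → EuclideanSpace ℝ (Fin 3) → EuclideanSpace ℝ (Fin 3),
      IsTypeIAncientMild C W ∧ HasTypeIDecay A W ∧
      (∀ s : ℝ, s < 0 → ∫⁻ x, ‖fderiv ℝ (W s) x‖ₑ ^ 2 ≤ ENNReal.ofReal (K / Real.sqrt (-s))) ∧
      (∀ r > 0, ∀ M : ℝ, ∃ t ∈ Ioo (-(r ^ 2)) (0 : ℝ),
        ∃ x ∈ ball (0 : EuclideanSpace ℝ (Fin 3)) r, M < ‖W t x‖) ∧
      (∃ l : ℕ → ℝ, (∀ k, 0 < l k) ∧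
        ∀ t < 0, ∀ x, Tendsto (fun k => nsRescale (l k) V t x) atTop (𝓝 (W t x))) ∧
      (∀ s : ℝ, (∫ y, ‖lerayVorticity W s y‖ ^ 2) ≤ ∫ y, ‖lerayVorticity W 0 y‖ ^ 2) ∧
      (∀ s : ℝ, (∫ y, ‖lerayVorticity V s y‖ ^ 2) ≤ ∫ y, ‖lerayVorticity W 0 y‖ ^ 2) := by
  -- equalised constants for compactness / continuity
  set B : ℝ := max C A with hBdef
  have hV' : IsTypeIAncientMild B V := isTypeIAncientMild_of_le hV (le_max_left C A)
  have hdec' : HasTypeIDecay B V := hasTypeIDecay_of_le hdec (le_max_right C A)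
  -- the similarity enstrophy of `V`, its ceiling and its supremum
  obtain ⟨Z, hZdef⟩ : ∃ Z : ℝ → ℝ, Z = fun σ => ∫ y, ‖lerayVorticity V σ y‖ ^ 2 := ⟨_, rfl⟩
  have hZσ : ∀ σ, Z σ = ∫ y, ‖lerayVorticity V σ y‖ ^ 2 := fun σ => by rw [hZdef]
  have hZle : ∀ σ, Z σ ≤ ‖curlCLM‖ ^ 2 * max K 0 := fun σ => by
    rw [hZσ]; exact (SmallDissipationGap.integrable_sq_norm_lerayVorticity hV hK σ).2
  have hbdd : BddAbove (range Z) := ⟨‖curlCLM‖ ^ 2 * max K 0, by rintro _ ⟨σ, rfl⟩; exact hZle σ⟩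
  obtain ⟨m, hmdef⟩ : ∃ m : ℝ, m = ⨆ σ, Z σ := ⟨_, rfl⟩
  have hZm : ∀ σ, Z σ ≤ m := fun σ => by rw [hmdef]; exact le_ciSup hbdd σ
  -- a maximising sequence of similarity times
  have hex : ∀ n : ℕ, ∃ σ : ℝ, m - 1 / ((n : ℝ) + 1) < Z σ := by
    intro n
    have : m - 1 / ((n : ℝ) + 1) < ⨆ σ, Z σ := by
      rw [← hmdef]; have : (0 : ℝ) < 1 / ((n : ℝ) + 1) := by positivity
      linarith
    exact exists_lt_of_lt_ciSup this
  choose sn hsn using hex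
  have hZlim : Tendsto (fun n => Z (sn n)) atTop (𝓝 m) := by
    have h1 : Tendsto (fun n : ℕ => m - 1 / ((n : ℝ) + 1)) atTop (𝓝 (m - 0)) :=
      tendsto_const_nhds.sub tendsto_one_div_add_atTop_nhds_zero_nat
    rw [sub_zero] at h1
    exact tendsto_of_tendsto_of_tendsto_of_le_of_le h1 tendsto_const_nhds
      (fun n => (hsn n).le) (fun n => hZm _)
  -- the rescalings bringing the slice `sn n` to `s = 0`
  obtain ⟨u, hudef⟩ : ∃ u : ℕ → ℝ → EuclideanSpace ℝ (Fin 3) → EuclideanSpace ℝ (Fin 3),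
      ∀ n, u n = nsRescale (Real.exp (-(sn n) / 2)) V := ⟨_, fun n => rfl⟩
  have hu : ∀ n, IsTypeIAncientMild B (u n) := fun n => by
    rw [hudef]; exact hV'.nsRescale (Real.exp_pos _)
  have hdu : ∀ n, HasTypeIDecay B (u n) := fun n => by
    rw [hudef]; exact hdec'.nsRescale (Real.exp_pos _)
  have hduA : ∀ n, HasTypeIDecay A (u n) := fun n => by
    rw [hudef]; exact hdec.nsRescale (Real.exp_pos _)
  have hlaw : ∀ n, ∀ s : ℝ, s < 0 →
      ∫⁻ x, ‖fderiv ℝ (u n s) x‖ₑ ^ 2 ≤ ENNReal.ofReal (K / Real.sqrt (-s)) := fun n => by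
    rw [hudef]; exact dissipationLaw_nsRescale hK (Real.exp_pos _)
  have hsu : ∀ n, ∀ r > 0, ∀ M : ℝ, ∃ t ∈ Ioo (-(r ^ 2)) (0 : ℝ),
      ∃ x ∈ ball (0 : EuclideanSpace ℝ (Fin 3)) r, M < ‖u n t x‖ := fun n => by
    rw [hudef]; exact singularAtOrigin_nsRescale hsing (Real.exp_pos _)
  have hub : ∀ n, ∀ t < 0, ∀ x, ‖u n t x‖ ≤ C / Real.sqrt (-t) := fun n t ht x => by
    rw [hudef]; exact (hV.nsRescale (Real.exp_pos _)).norm_le ht x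
  -- KNSS compactness
  obtain ⟨ψ, hψ, W, hW, hunif, hpt, hgr⟩ := Compactness.seqLimit hu
  have hψt : Tendsto ψ atTop atTop := hψ.tendsto_atTop
  -- the limit: class `C`, envelope `A`, law `K`, singular
  have hWC : IsTypeIAncientMild C W := by
    obtain ⟨h1, h2, h3, -⟩ := hW
    refine ⟨h1, h2, h3, fun t ht x => ?_⟩
    exact le_of_tendsto (hpt t ht x).norm (Eventually.of_forall fun j => hub (ψ j) t ht x)
  have hdW : HasTypeIDecay A W := fun t ht x =>
    le_of_tendsto (hpt t ht x).norm (Eventually.of_forall fun j => hduA (ψ j) t ht x)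
  have hdWB : HasTypeIDecay B W := hasTypeIDecay_of_le hdW (le_max_right C A)
  have hWlaw : ∀ s : ℝ, s < 0 →
      ∫⁻ x, ‖fderiv ℝ (W s) x‖ₑ ^ 2 ≤ ENNReal.ofReal (K / Real.sqrt (-s)) :=
    Compactness.law_of_seqLimit (Kk := fun _ => K) (Kinf := K) hψt hlaw
      (fun ε hε => Eventually.of_forall fun k => by linarith) hgr
  have hWsing := Compactness.persistent_singularity_seq (w := fun j => u (ψ j))
    (fun j => hu _) (fun j => hlaw _) (fun j => hsu _) hW hunif
  -- every slice enstrophy of `W` is a limit of slice enstrophies of `V`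
  have hZW : ∀ σ : ℝ, Tendsto (fun j => Z (σ + sn (ψ j))) atTop
      (𝓝 (∫ y, ‖lerayVorticity W σ y‖ ^ 2)) := by
    intro σ
    obtain ⟨c, hcdef⟩ : ∃ c : ℝ, c = Real.exp (-σ / 2) := ⟨_, rfl⟩
    have hc : 0 < c := by rw [hcdef]; exact Real.exp_pos _
    have hlogc : 2 * Real.log c = -σ := by rw [hcdef, Real.log_exp]; ring
    have hc2 : c ^ 2 * (-1) < 0 := by
      have : 0 < c ^ 2 := by positivity
      linarith
    obtain ⟨u', hu'def⟩ : ∃ u' : ℕ → ℝ → EuclideanSpace ℝ (Fin 3) → EuclideanSpace ℝ (Fin 3),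
        ∀ j, u' j = nsRescale c (u (ψ j)) := ⟨_, fun j => rfl⟩
    have hu' : ∀ j, IsTypeIAncientMild B (u' j) := fun j => by
      rw [hu'def]; exact (hu (ψ j)).nsRescale hc
    have hdu' : ∀ j, HasTypeIDecay B (u' j) := fun j => by
      rw [hu'def]; exact (hdu (ψ j)).nsRescale hc
    have hgr' : ∀ x, Tendsto (fun j => fderiv ℝ (u' j (-1)) x) atTop
        (𝓝 (fderiv ℝ (nsRescale c W (-1)) x)) := by
      intro x
      simp only [hu'def, fderiv_nsRescale]
      exact (hgr _ hc2 (c • x)).const_smul (c * c)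
    have hlim := tendsto_integral_sq_norm_curl_neg_one hu' hdu' hgr'
    have e1 : ∀ j, (∫ x, ‖curl (u' j (-1)) x‖ ^ 2) = Z (σ + sn (ψ j)) := by
      intro j
      rw [← enstrophy_zero_eq, hu'def, enstrophy_nsRescale hc, hudef,
        enstrophy_nsRescale (Real.exp_pos _), Real.log_exp, hlogc, hZσ]
      congr 2
      ring
    have e2 : (∫ x, ‖curl (nsRescale c W (-1)) x‖ ^ 2) = ∫ y, ‖lerayVorticity W σ y‖ ^ 2 := by
      rw [← enstrophy_zero_eq, enstrophy_nsRescale hc, hlogc, zero_sub, neg_neg]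
    rw [e2] at hlim
    simp_rw [e1] at hlim
    exact hlim
  -- at `σ = 0` the limit is `m`; every other slice is `≤ m`
  have hZW0 : (∫ y, ‖lerayVorticity W 0 y‖ ^ 2) = m := by
    have h := hZW 0
    simp_rw [zero_add] at h
    exact tendsto_nhds_unique h (hZlim.comp hψt)
  have hZWle : ∀ σ, (∫ y, ‖lerayVorticity W σ y‖ ^ 2) ≤ m := fun σ =>
    le_of_tendsto' (hZW σ) fun j => hZm _
  refine ⟨W, hWC, hdW, hWlaw, hWsing, ⟨fun k => Real.exp (-(sn (ψ k)) / 2), fun k => Real.exp_pos _,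
    fun t ht x => ?_⟩, fun s => by rw [hZW0]; exact hZWle s, fun s => by rw [hZW0, ← hZσ]; exact hZm s⟩
  have := hpt t ht x
  simp only [hudef] at this
  exact this

/-- **THE WINDOW HOLDS EXACTLY ON THE EXTREMAL SLICE.** With `V` as above there is `W` in the same
class (Type-I constant `C`, envelope `A`, law `K`), singular, a pointwise limit of rescalings of `V`,
such that at the slice `t = −1`: `m := ∫‖curl W(−1)‖²` is the supremum of `√(−t)∫‖curl V(t)‖²` over
`t < 0` (and of the same quantity for `W`), and with `D := ∫‖curl curl W(−1)‖²`:
**`(4D + m)² ≤ 16C²·m·D`** — the vorticity Taylor microscale of the extremal slice lies in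
`[2(C−√(C²−1)), 2(C+√(C²−1))]` exactly. [folklore energy method + KNSS compactness] -/
theorem exists_extremal_window (hV : IsTypeIAncientMild C V) (hdec : HasTypeIDecay A V)
    (hK : ∀ s : ℝ, s < 0 → ∫⁻ x, ‖fderiv ℝ (V s) x‖ₑ ^ 2 ≤ ENNReal.ofReal (K / Real.sqrt (-s)))
    (hsing : ∀ r > 0, ∀ M : ℝ, ∃ t ∈ Ioo (-(r ^ 2)) (0 : ℝ),
      ∃ x ∈ ball (0 : EuclideanSpace ℝ (Fin 3)) r, M < ‖V t x‖) :
    ∃ W : ℝ → EuclideanSpace ℝ (Fin 3) → EuclideanSpace ℝ (Fin 3),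
      IsTypeIAncientMild C W ∧ HasTypeIDecay A W ∧
      (∀ s : ℝ, s < 0 → ∫⁻ x, ‖fderiv ℝ (W s) x‖ₑ ^ 2 ≤ ENNReal.ofReal (K / Real.sqrt (-s))) ∧
      (∀ r > 0, ∀ M : ℝ, ∃ t ∈ Ioo (-(r ^ 2)) (0 : ℝ),
        ∃ x ∈ ball (0 : EuclideanSpace ℝ (Fin 3)) r, M < ‖W t x‖) ∧
      (∃ l : ℕ → ℝ, (∀ k, 0 < l k) ∧
        ∀ t < 0, ∀ x, Tendsto (fun k => nsRescale (l k) V t x) atTop (𝓝 (W t x))) ∧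
      (∀ t : ℝ, t < 0 → Real.sqrt (-t) * ∫ x, ‖curl (V t) x‖ ^ 2 ≤ ∫ x, ‖curl (W (-1)) x‖ ^ 2) ∧
      (∀ t : ℝ, t < 0 → Real.sqrt (-t) * ∫ x, ‖curl (W t) x‖ ^ 2 ≤ ∫ x, ‖curl (W (-1)) x‖ ^ 2) ∧
      (4 * (∫ x, ‖curl (curl (W (-1))) x‖ ^ 2) + ∫ x, ‖curl (W (-1)) x‖ ^ 2) ^ 2 ≤
        16 * C ^ 2 * ((∫ x, ‖curl (W (-1)) x‖ ^ 2) * ∫ x, ‖curl (curl (W (-1))) x‖ ^ 2) := by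
  obtain ⟨W, hWC, hdW, hWlaw, hWsing, hlim, hmaxW, hmaxV⟩ := exists_extremal_slice hV hdec hK hsing
  -- physical reading of the similarity enstrophy: `Z(s) = √(−t)∫‖curl V(t)‖²`, `t = −e^{−s}`
  have hphys : ∀ (F : ℝ → EuclideanSpace ℝ (Fin 3) → EuclideanSpace ℝ (Fin 3)) (t : ℝ), t < 0 →
      Real.sqrt (-t) * ∫ x, ‖curl (F t) x‖ ^ 2 =
        ∫ y, ‖lerayVorticity F (-Real.log (-t)) y‖ ^ 2 := by
    intro F t ht
    rw [Trapping.integral_sq_norm_lerayVorticity_eq, neg_neg, Real.exp_log (neg_pos.2 ht), neg_neg]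
    congr 1
    rw [show Real.log (-t) / 2 = Real.log (Real.sqrt (-t)) by
      rw [Real.log_sqrt (neg_pos.2 ht).le], Real.exp_log (Real.sqrt_pos.2 (neg_pos.2 ht))]
  have hZ0 : (∫ y, ‖lerayVorticity W 0 y‖ ^ 2) = ∫ x, ‖curl (W (-1)) x‖ ^ 2 := enstrophy_zero_eq W
  -- the slice `s = 0` is a global maximum, so the derivative vanishes there
  have hmax : IsLocalMax (fun σ => ∫ y, ‖lerayVorticity W σ y‖ ^ 2) 0 :=
    Eventually.of_forall fun σ => hmaxW σ
  have hderiv : deriv (fun σ => ∫ y, ‖lerayVorticity W σ y‖ ^ 2) 0 = 0 := hmax.deriv_eq_zero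
  have hwin := window_of_deriv_nonneg' hWC hdW (s := 0) (le_of_eq hderiv.symm)
  have hD0 : (∫ y, ‖curl (lerayVorticity W 0) y‖ ^ 2) = ∫ x, ‖curl (curl (W (-1))) x‖ ^ 2 := by
    have : lerayOrbit W 0 = W (-1) := by
      funext y; rw [lerayOrbit_apply]; simp
    rw [lerayVorticity_apply, this]
  rw [hZ0, hD0] at hwin
  refine ⟨W, hWC, hdW, hWlaw, hWsing, hlim, fun t ht => ?_, fun t ht => ?_, hwin⟩
  · rw [hphys V t ht, ← hZ0]; exact hmaxV _
  · rw [hphys W t ht, ← hZ0]; exact hmaxW _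

end Summit.NavierStokesRegularity.NavierStokesRegularity.Theorems.FiniteDissipationLiouville.MicroscaleWindow

end
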